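import Mathlib
import Literature.Computability.AlgebraicComplexity.NestFreeMatchingPoly
import Literature.Computability.AlgebraicComplexity.CircuitDepthProofs
import Summits.ValiantsHypothesis.ValiantsHypothesis.Theorems.FifoMatchingNNDivisionHardHyperDegree
import Summits.ValiantsHypothesis.ValiantsHypothesis.Theses.FifoMatching
import HarnessLib

/-!
# `NN_n` is hard for monotone FORMULAS WITH DIVISION — the formula-model analogue of crux
# `Theses.FifoMatching.NNDivisionHard` (stmt-ValiantsHypothesis-21181) HOLDS, cofactor uncharged, no degree cap

Route `ValiantsHypothesis/FifoMatching`, helper toward item stmt-ValiantsHypothesis-21181 (`NNDivisionHard`: for every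
`c`, eventually in `n`, every nonzero cofactor `h ∈ ℝ≥0[x]` has `2^((log₂ n + c)^c) < L₊(NN_n · h) + L₊(h)`, `L₊` the
monotone fan-in-two CIRCUIT size `complexity` over `ℝ≥0`).  This file proves the same statement with the monotone
fan-in-two FORMULA size `E₊ = formulaComplexity` over `ℝ≥0` in place of `L₊`, in the stronger UNCHARGED and
EXPONENTIAL form:

* `formulaExpRung_of_count` — from the NFP shadow count of the tree's located-face chain (hypothesis verbatim the one
  of `GridCorShadow.expRung_of_count`): eventually in `n`, EVERY nonzero `h` has `2^{⌊n^{1/8}⌋} < E₊(NN_n · h)`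
  (`⌊n^{1/8}⌋ := Nat.sqrt (Nat.sqrt (Nat.sqrt n))`).  Proof: a fan-in-two monotone formula of size `E` for `NN_n · h`
  caps every planar shadow of `NFP_n = Newt(NN_n)` at `4(3E+1)` vertices (`GridCorShadow.nn_ncard_extremePoints_le_of_multiple`
  = HY21 Thm 42, NN instance: a Minkowski summand has at most as many uniquely supported pencil points), against a shadow
  with more than `2^{⌊n^{1/8}⌋+4}` vertices (`GridCorShadow.exp_threshold`).  Unlike the circuit rung R2-exp
  (`GridCorShadow.expRung_of_count`) NO balancing (`formulaComplexity_le_two_pow`, BCS (21.35)/(21.36)) is used, so NO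
  degree hypothesis on `h` is needed: the hyper-degree cofactors that carry the residual content of 21181 in the circuit
  model are harmless in the formula model.
* `formulaExpRung_of_27045`, ★ `formulaExpRung_holds` — the same from the CLOSED route item G♭ `GridCorCliqueFace`
  (stmt-27045, `gridCorCliqueFace_holds`) through `GridCorShadow.gridCor_count` / `pp_count` / `nfp_count`, UNCONDITIONAL.
* ★ `nnFormulaMultiplesHard` — quasi-polynomial threshold, uncharged: `∀ c, ∃ n₀, ∀ n ≥ n₀, ∀ h ≠ 0,
  2^((log₂ n + c)^c) < E₊(NN_n · h)`.  This is, for `NN_n`, VERBATIM the statement that route `DivisionGap` files for the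
  permanent as the OPEN piece `PerFormulaMultiplesHard` (`Theorems/DivisionGapPerDivisionHardFormulaSplit.lean`; open for
  `per_n` because `σ(DS_n)` super-quasi-polynomial is HY21 Open Problem 1): the queue family is PROVABLY formula-division-hard.
* ★★ `nnFormulaDivisionHard` — the charged form with the route's INLINED `NN_n` (definitionally `nestFreeMatchingPoly n ℝ≥0`):
  the route decl `NNDivisionHard` with `complexity` replaced by `formulaComplexity`, PROVED.
* `nnFormulaDivisionHard_of_nnDivisionHard` — ladder position: the crux 21181 implies the formula form (`L₊ ≤ E₊`,
  `complexity_le_formulaComplexity_holds`); the converse direction is exactly where the circuit model is open (balancing a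
  circuit into a formula needs a degree bound, and hyper-degree cofactors have none).

HONEST FRAMING: a FORMULA-model (hence weaker-model) statement in the monotone world; it does not close stmt-21181 (circuit
model), does not bear on `NNNotVP` (Literature.Barriers.ValiantsHypothesis.MonotoneGap), and VP ≠ VNP is NOT proved by
anything here.

References: P. Hrubeš, A. Yehudayoff, *Shadows of Newton polytopes*, CCC 2021 (LIPIcs 200:9), Thm 1 / Lemma 12 / Thm 42,
§6 Problem 2, Open Problems 1–3 [HrubesYehudayoff2021]; M. Aboulker, S. Fiorini, T. Huynh, M. Macchia, J. Seif, Oper. Res.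
Lett. 47 (2019) Thm 6 [AboulkerEtAl2019]; S. Jukna, *Tropical Circuit Complexity* (2023) §6 Problem 4 [Jukna2023].
-/

set_option autoImplicit false

-- the mandated summit-side namespace repeats a component by design (single-problem summit)
set_option linter.dupNamespace false

noncomputable section

namespace Summit.ValiantsHypothesis.ValiantsHypothesis.Theorems.FifoMatching

namespace FormulaDivision

open scoped NNReal BigOperators Classical
open MvPolynomial
open Literature.Computability.AlgebraicComplexity
open Literature.Combinatorics.Optimization (corVec)
open Literature.Computability.MetaComplexity (gridGraph)
open Summit.ValiantsHypothesis.ValiantsHypothesis.Theorems.FifoMatching.QueueGridFace (suppPts QGV patternVec)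
open Summit.ValiantsHypothesis.ValiantsHypothesis.Theses.FifoMatching (GridCorCliqueFace)
open Summit.ValiantsHypothesis.ValiantsHypothesis.Theorems.FifoMatching.GridCorShadow

/-! ## S-exp for formulas: no balancing, no degree cap -/

/-- **S-exp in the formula model.**  If, eventually in `n`, `NFP_n = conv(suppPts NN_n)` has a planar shadow with more than
`B` vertices whenever `16 B < 2^H`, for some `H ≥ c₀ · ⌊(⌊√n⌋/2 − 1)/2⌋` (`c₀ ∈ (0,1]`; the NFP count of the located-face
chain, verbatim the hypothesis of `GridCorShadow.expRung_of_count`), then eventually in `n` EVERY nonzero cofactor `h` has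
`2^{⌊n^{1/8}⌋} < E₊(NN_n · h)`, `E₊ = formulaComplexity` over `ℝ≥0` — with NO hypothesis on the degree of `h`.
[cite: HrubesYehudayoff2021, Thm 42 (= Thm 1 with Lemma 12)] -/
theorem formulaExpRung_of_count {c₀ : ℝ} (hc₀ : 0 < c₀) (hc₁ : c₀ ≤ 1) {n₀ : ℕ}
    (hN : ∀ n ≥ n₀, ∃ h : ℕ, c₀ * ((((Nat.sqrt n / 2 - 1) / 2 : ℕ)) : ℝ) ≤ h ∧ ∀ B : ℕ, 16 * B < 2 ^ h →
      ∃ L : ((Fin (2 * n) × Fin (2 * n)) → ℝ) →ₗ[ℝ] (Fin 2 → ℝ),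
        B < (Set.extremePoints ℝ (convexHull ℝ (L '' suppPts (nestFreeMatchingPoly n ℝ≥0)))).ncard) :
    ∃ n₀ : ℕ, ∀ n ≥ n₀, ∀ h : MvPolynomial (Fin (2 * n) × Fin (2 * n)) ℝ≥0, h ≠ 0 →
      2 ^ Nat.sqrt (Nat.sqrt (Nat.sqrt n)) < formulaComplexity (nestFreeMatchingPoly n ℝ≥0 * h) := by
  obtain ⟨n₁, hn₁⟩ := exp_threshold hc₀ hc₁
  refine ⟨max n₀ n₁, fun n hn h hh => ?_⟩
  have hn0 : n₀ ≤ n := le_of_max_le_left hn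
  have hn1 : n₁ ≤ n := le_of_max_le_right hn
  by_contra hs
  push Not at hs
  obtain ⟨H, hH, hcount⟩ := hN n hn0
  set m := Nat.sqrt (Nat.sqrt (Nat.sqrt n)) with hm
  have harith : 18 * (m + 2 * Nat.log 2 n + 5) ^ 2 + 8 < H := hn₁ n hn1 H hH
  have hmH : m + 8 < H := by
    have hx : m ≤ (m + 2 * Nat.log 2 n + 5) ^ 2 :=
      le_trans (by omega : m ≤ m + 2 * Nat.log 2 n + 5) (Nat.le_self_pow two_ne_zero _)
    generalize (m + 2 * Nat.log 2 n + 5) ^ 2 = y at hx harith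
    omega
  have h16 : 16 * 2 ^ (m + 4) = 2 ^ (m + 8) := by ring
  obtain ⟨L, hL⟩ := hcount (2 ^ (m + 4)) (by
    rw [h16]
    exact Nat.pow_lt_pow_right (by norm_num) hmH)
  have hV := nn_ncard_extremePoints_le_of_multiple L h hh
  have h2m : 2 ^ (m + 4) = 16 * 2 ^ m := by ring
  have hone : 1 ≤ 2 ^ m := Nat.one_le_two_pow
  have hfinal : (Set.extremePoints ℝ (convexHull ℝ (L '' suppPts (nestFreeMatchingPoly n ℝ≥0)))).ncard ≤
      2 ^ (m + 4) :=
    calc (Set.extremePoints ℝ (convexHull ℝ (L '' suppPts (nestFreeMatchingPoly n ℝ≥0)))).ncard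
        ≤ 4 * (3 * formulaComplexity (nestFreeMatchingPoly n ℝ≥0 * h) + 1) := hV
      _ ≤ 4 * (3 * 2 ^ m + 1) := Nat.mul_le_mul_left 4 (Nat.add_le_add_right (Nat.mul_le_mul_left 3 hs) 1)
      _ ≤ 2 ^ (m + 4) := by
          rw [h2m]
          generalize 2 ^ m = y at hone ⊢
          omega
  exact absurd hL (not_lt.2 hfinal)

/-- **The formula exp rung from G♭, BY NAME**: the route item `GridCorCliqueFace` (stmt-27045) gives — eventually in `n` —
`2^{⌊n^{1/8}⌋} < E₊(NN_n · h)` for EVERY nonzero cofactor `h` (any degree), via the located faces of the shadow chain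
(`GridCorShadow.gridCor_count`, `pp_count`, `nfp_count`, exactly as in `GridCorShadow.expRung_of_27045`).
[cite: HrubesYehudayoff2021, Prop 19 / Lemma 10 / Thm 42] [cite: AboulkerEtAl2019, Thm 6 (pp. 5–6)] -/
theorem formulaExpRung_of_27045 (hF : GridCorCliqueFace) :
    ∃ n₀ : ℕ, ∀ n ≥ n₀, ∀ h : MvPolynomial (Fin (2 * n) × Fin (2 * n)) ℝ≥0, h ≠ 0 →
      2 ^ Nat.sqrt (Nat.sqrt (Nat.sqrt n)) < formulaComplexity (nestFreeMatchingPoly n ℝ≥0 * h) := by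
  obtain ⟨c₀, hc₀, t₀, hG⟩ := gridCor_count hF
  have hc₁ : 0 < min c₀ 1 := lt_min hc₀ one_pos
  have hc₁1 : min c₀ 1 ≤ 1 := min_le_right _ _
  have hG' : ∀ t ≥ t₀, ∃ h : ℕ, min c₀ 1 * t ≤ h ∧ ∀ B : ℕ, 4 * B < 2 ^ h →
      ∃ L : ((Fin (t * t) × Fin (t * t)) → ℝ) →ₗ[ℝ] (Fin 2 → ℝ),
        B < (Set.extremePoints ℝ (convexHull ℝ (L '' Set.range (corVec (gridGraph t))))).ncard := by
    intro t ht
    obtain ⟨h, hh, hc⟩ := hG t ht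
    exact ⟨h, (mul_le_mul_of_nonneg_right (min_le_left _ _) (Nat.cast_nonneg t)).trans hh, hc⟩
  have hP : ∀ r ≥ 2 * t₀ + 2, _ := fun r hr => pp_count hG' r hr
  have hN : ∀ n ≥ 4 * (max (2 * t₀ + 2 + 1) 3) ^ 2, _ := fun n hn => nfp_count hP n hn
  exact formulaExpRung_of_count hc₁ hc₁1 hN

/-- ★ **`NN_n` IS EXPONENTIALLY HARD FOR MONOTONE FORMULAS WITH DIVISION, UNCONDITIONALLY**: eventually in `n`,
`2^{⌊n^{1/8}⌋} < E₊(NN_n · h)` for EVERY nonzero cofactor `h ∈ ℝ≥0[x]` — no degree cap, cofactor uncharged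
(`⌊n^{1/8}⌋ := Nat.sqrt (Nat.sqrt (Nat.sqrt n))`; from the CLOSED item 27045 `gridCorCliqueFace_holds`).
[cite: HrubesYehudayoff2021, Thm 42 with Prop 19 / Lemma 10] [cite: AboulkerEtAl2019, Thm 6 (pp. 5–6)] -/
theorem formulaExpRung_holds :
    ∃ n₀ : ℕ, ∀ n ≥ n₀, ∀ h : MvPolynomial (Fin (2 * n) × Fin (2 * n)) ℝ≥0, h ≠ 0 →
      2 ^ Nat.sqrt (Nat.sqrt (Nat.sqrt n)) < formulaComplexity (nestFreeMatchingPoly n ℝ≥0 * h) :=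
  formulaExpRung_of_27045 gridCorCliqueFace_holds

/-! ## The quasi-polynomial forms: the NN twin of `PerFormulaMultiplesHard`, and the formula-model `NNDivisionHard` -/

/-- ★ **`NNFormulaMultiplesHard` (uncharged, quasi-polynomial threshold) — PROVED**: for every `c`, eventually in `n`,
every monotone fan-in-two FORMULA over `ℝ≥0` computing a nonzero multiple `NN_n · h` has size `> 2^((log₂ n + c)^c)`.
For the permanent the verbatim twin `PerFormulaMultiplesHard` of route `DivisionGap` is OPEN (it needs `σ(DS_n)`
super-quasi-polynomial, HY21 Open Problem 1); for the queue family it holds. [cite: HrubesYehudayoff2021, Thm 42, §6 Problem 2] -/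
theorem nnFormulaMultiplesHard :
    ∀ c : ℕ, ∃ n₀ : ℕ, ∀ n ≥ n₀, ∀ h : MvPolynomial (Fin (2 * n) × Fin (2 * n)) ℝ≥0, h ≠ 0 →
      2 ^ ((Nat.log 2 n + c) ^ c) < formulaComplexity (nestFreeMatchingPoly n ℝ≥0 * h) := by
  intro c
  obtain ⟨n₁, hn₁⟩ := formulaExpRung_holds
  obtain ⟨n₂, hn₂⟩ := NNDivisionHard.HyperDegree.polylog_le_root8 c
  refine ⟨max n₁ n₂, fun n hn h hh => ?_⟩
  exact lt_of_le_of_lt (Nat.pow_le_pow_right Nat.two_pos (hn₂ n (le_of_max_le_right hn)))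
    (hn₁ n (le_of_max_le_left hn) h hh)

/-- ★★ **`NNFormulaDivisionHard` — the FORMULA-MODEL ANALOGUE OF CRUX stmt-ValiantsHypothesis-21181, PROVED**: the route decl
`Theses.FifoMatching.NNDivisionHard` with the monotone circuit size `complexity` replaced by the monotone fan-in-two formula
size `formulaComplexity` (same inlined `NN_n`, same threshold, same charge `+ E₊(h)`): for every `c`, eventually in `n`,
every nonzero `h ∈ ℝ≥0[x]` has `2^((log₂ n + c)^c) < E₊(NN_n · h) + E₊(h)`.  The route's inlined `NN_n` is definitionally
the library's `nestFreeMatchingPoly n ℝ≥0`. [cite: HrubesYehudayoff2021, Thm 42, §6 Problem 2] -/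
theorem nnFormulaDivisionHard :
    ∀ c : ℕ, ∃ n₀ : ℕ, ∀ n ≥ n₀, ∀ h : MvPolynomial (Fin (2 * n) × Fin (2 * n)) NNReal, h ≠ 0 → 2 ^ ((Nat.log 2 n + c) ^ c) < Literature.Computability.AlgebraicComplexity.formulaComplexity ((∑ M : Fin (2 * n) → Fin (2 * n), if ((∀ i, M (M i) = i) ∧ (∀ i, M i ≠ i) ∧ ∀ i j, i < j → j < M j → M j < M i → False) then ∏ i : Fin (2 * n), (if i < M i then MvPolynomial.X (i, M i) else 1) else (0 : MvPolynomial (Fin (2 * n) × Fin (2 * n)) NNReal)) * h) + Literature.Computability.AlgebraicComplexity.formulaComplexity h := by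
  intro c
  obtain ⟨n₀, hn₀⟩ := nnFormulaMultiplesHard c
  refine ⟨n₀, fun n hn h hh => ?_⟩
  show 2 ^ ((Nat.log 2 n + c) ^ c) < formulaComplexity (nestFreeMatchingPoly n ℝ≥0 * h) + formulaComplexity h
  exact Nat.lt_add_right _ (hn₀ n hn h hh)

/-- **Ladder position**: the crux `NNDivisionHard` (stmt-21181, circuit model) implies the formula form, since a formula is a
circuit (`L₊ ≤ E₊`, `complexity_le_formulaComplexity_holds`).  The converse is the open content of 21181: balancing a monotone
circuit into a formula (`formulaComplexity_le_two_pow`, BCS (21.35)/(21.36)) needs a degree bound, which hyper-degree cofactors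
lack. [cite: BurgisserClausenShokrollahi1997, §21.1 p. 549] -/
theorem nnFormulaDivisionHard_of_nnDivisionHard
    (hD : Summit.ValiantsHypothesis.ValiantsHypothesis.Theses.FifoMatching.NNDivisionHard) :
    ∀ c : ℕ, ∃ n₀ : ℕ, ∀ n ≥ n₀, ∀ h : MvPolynomial (Fin (2 * n) × Fin (2 * n)) ℝ≥0, h ≠ 0 →
      2 ^ ((Nat.log 2 n + c) ^ c) < formulaComplexity (nestFreeMatchingPoly n ℝ≥0 * h) + formulaComplexity h := by
  intro c
  obtain ⟨n₀, hn₀⟩ := hD c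
  refine ⟨n₀, fun n hn h hh => ?_⟩
  have hlt : 2 ^ ((Nat.log 2 n + c) ^ c) < complexity (nestFreeMatchingPoly n ℝ≥0 * h) + complexity h :=
    hn₀ n hn h hh
  exact lt_of_lt_of_le hlt (Nat.add_le_add (complexity_le_formulaComplexity_holds _)
    (complexity_le_formulaComplexity_holds _))

end FormulaDivision

end Summit.ValiantsHypothesis.ValiantsHypothesis.Theorems.FifoMatching

end
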